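import Mathlib

/-!
# H-theorem from macroscopic autonomy (De Roeck–Maes–Netočný 2006, Proposition 3.1)

Literature layer, topic `Literature/MathematicalPhysics/StatisticalMechanics`. Named fact (D-0014:
no proof is vendored; the fact is a `def … : Prop`, users take it as a hypothesis).

Source: W. De Roeck, C. Maes, K. Netočný, *H-theorems from macroscopic autonomous equations*,
J. Stat. Phys. **123** (2006) 571–584, doi:10.1007/s10955-006-9079-x, arXiv:cond-mat/0508089,
§3 "Classical dynamical systems", §3.1 "Infinite scale separation", Proposition 3.1.
[RoeckMaesNetocny2006]

Printed setting (§3). `N` indexes dynamical systems `(Ω^N, U^N_t, ρ^N)`: `ρ^N` is a probability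
measure on the phase space `Ω^N`, invariant under the dynamics `U^N_t : Ω^N → Ω^N`; a map
`m^N : Ω^N → 𝓕` into a metric space `(𝓕, d)` independent of `N` gives the macroscopic state;
`m' =^δ m` means `d(m', m) ≤ δ`.
* (3.2) `H(m) ≡ lim_{δ↓0} lim_{N↑∞} N⁻¹ log ρ^N(m^N(x) =^δ m)` — "That need not exist in general,
  but we make that definition part of our assumptions and set-up."
* (3.3) autonomy: there are an interval `[0,T]` and maps `φ_t : 𝓕 → 𝓕`, `t ∈ [0,T]`, such that for
  all `m ∈ 𝓕`, `δ > 0` and `0 ≤ s ≤ t ≤ T`,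
  `lim_{ε↓0} lim_{N↑∞} N⁻¹ log ρ^N( m^N(U^N_t x) =^δ φ_t(m) | m^N(U^N_s x) =^ε φ_s(m) ) = 0`.
* **Proposition 3.1.** `∀ m ∈ 𝓕` and all `0 ≤ s ≤ t ≤ T`: `H(φ_t(m)) ≥ H(φ_s(m))`.
  (Proof, printed: `log ρ^N(m^N(x) =^δ φ_t m) = log ρ^N(m^N(U_t x) =^δ φ_t m) ≥
  log ρ^N(m^N(U_t x) =^δ φ_t m | m^N(U_s x) =^ε φ_s m) + log ρ^N(m^N(U_s x) =^ε φ_s m)`, invariance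
  of `ρ^N` again in the last term, divide by `N`, `N ↑ ∞`, then `ε ↓ 0`, then `δ ↓ 0`; only the
  invariance of `ρ^N` under `U^N_s` and `U^N_t`, `s, t ∈ [0,T]`, is used.)

Typing choices. Normalised log-probabilities `N⁻¹ log p` live in `EReal` via `ENNReal.log`
(`log 0 = ⊥`), so macrostates of probability zero have entropy `-∞`, as in the paper where
`H ∈ [-∞, 0]`; conditional probabilities are Mathlib's `ProbabilityTheory.cond` (`ρ[|B] A =
ρ(B)⁻¹ ρ(B ∩ A)`); the iterated limits (3.2), (3.3) are typed as the existence of the inner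
`N ↑ ∞` limits (`h δ`, `g ε`) together with the outer one-sided limits `δ ↓ 0`, `ε ↓ 0`
(`𝓝[>] 0`). Measurability of `m^N` and of `U^N_t` (tacit in print) is explicit. The data
`ρ, U, m^N, T, φ, H` are parameters of the fact.

Use. This is the abstract skeleton — Liouville invariance + a large-deviation entropy + macroscopic
autonomy ⇒ monotone Boltzmann entropy — cited by route theses on the hard-sphere hydrodynamic
limit (e.g. the crux
`Summit.AtomisticToContinuum.HydrodynamicLimit.Theses.LoschmidtIsentropicSelection.LimitSecondLaw`,
"De Roeck–Maes–Netočný run forward"). That crux is NOT an instance of this fact: there the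
initial law is a local Gibbs law (not `ρ^N` conditioned on a macrostate), `H` is the explicit
hard-sphere entropy functional, and the static large-deviation identification of (3.2) for the
canonical hard-sphere Gibbs law is a separate, unformalised input (Georgii 1994; Georgii–Zessin
1993).
-/

noncomputable section

namespace Literature.MathematicalPhysics.StatisticalMechanics

open MeasureTheory Filter Set Topology ProbabilityTheory
open scoped ENNReal

namespace AutonomyHTheorem

variable {Ω : Type*} {F : Type*} [MetricSpace F]

/-- The macrostate event `{x | d(m^N(x), m) ≤ δ}`, printed `m^N(x) =^δ m`.
[cite: RoeckMaesNetocny2006, §3 (notation before §3.1)] -/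
def macroEvent (mN : Ω → F) (m : F) (δ : ℝ) : Set Ω :=
  {x | dist (mN x) m ≤ δ}

/-- The normalised log-probability `N⁻¹ log p ∈ [-∞, 0]` of `p ∈ [0, 1]` (`log 0 = -∞`), the
quantity whose iterated limits define the entropy (3.2) and the autonomy condition (3.3).
[cite: RoeckMaesNetocny2006, §3.1 eq. (3.2)] -/
def normLog (N : ℕ) (p : ℝ≥0∞) : EReal :=
  (((N : ℝ)⁻¹ : ℝ) : EReal) * ENNReal.log p

/-- Macrostate events of a measurable macroscopic map are measurable (closed `δ`-ball preimage).
[folklore] -/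
theorem measurableSet_macroEvent [MeasurableSpace Ω] [MeasurableSpace F] [OpensMeasurableSpace F]
    {mN : Ω → F} (hm : Measurable mN) (m : F) (δ : ℝ) : MeasurableSet (macroEvent mN m δ) :=
  measurableSet_le (by fun_prop) measurable_const

end AutonomyHTheorem

open AutonomyHTheorem in
/-- **De Roeck–Maes–Netočný 2006, Proposition 3.1 (H-theorem from macroscopic autonomy, infinite
scale separation).** Let `(Ω^N, U^N_t, ρ^N)_N` be dynamical systems with `ρ^N` probability
measures invariant under the (measurable) maps `U^N_t`, `t ∈ [0,T]`, and `m^N : Ω^N → 𝓕`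
measurable macroscopic maps into a metric space. Assume (3.2): for every `m ∈ 𝓕` the entropy
`H(m) = lim_{δ↓0} lim_{N↑∞} N⁻¹ log ρ^N(m^N(x) =^δ m)` exists (inner limits `h δ`, outer one-sided
limit `H m`, values in `[-∞, 0] ⊆ EReal`); and (3.3): for all `m`, `δ > 0`, `0 ≤ s ≤ t ≤ T`,
`lim_{ε↓0} lim_{N↑∞} N⁻¹ log ρ^N( m^N(U^N_t x) =^δ φ_t(m) | m^N(U^N_s x) =^ε φ_s(m) ) = 0`
(inner limits `g ε` exist, outer one-sided limit `0`). Then for all `m ∈ 𝓕` and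
`0 ≤ s ≤ t ≤ T`, `H(φ_s(m)) ≤ H(φ_t(m))`. Vendored as the printed skeleton behind (it does not
instantiate to) the crux
`Summit.AtomisticToContinuum.HydrodynamicLimit.Theses.LoschmidtIsentropicSelection.LimitSecondLaw`.
[cite: RoeckMaesNetocny2006, §3.1 Prop. 3.1] -/
def DeRoeckMaesNetocny2006_prop31 {Ω : ℕ → Type*} [∀ N, MeasurableSpace (Ω N)]
    (ρ : (N : ℕ) → Measure (Ω N)) (U : (N : ℕ) → ℝ → Ω N → Ω N)
    {F : Type*} [MetricSpace F] [MeasurableSpace F] [BorelSpace F]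
    (mN : (N : ℕ) → Ω N → F) (T : ℝ) (φ : ℝ → F → F) (H : F → EReal) : Prop :=
  (∀ N, IsProbabilityMeasure (ρ N)) →
  (∀ N, Measurable (mN N)) →
  (∀ N, ∀ t ∈ Set.Icc 0 T, MeasurePreserving (U N t) (ρ N) (ρ N)) →
  -- (3.2): the Boltzmann entropy `H` as an iterated limit (its existence is an assumption)
  (∀ m : F, ∃ h : ℝ → EReal,
    (∀ δ : ℝ, 0 < δ →
      Tendsto (fun N => normLog N (ρ N (macroEvent (mN N) m δ))) atTop (𝓝 (h δ))) ∧
    Tendsto h (𝓝[>] 0) (𝓝 (H m))) →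
  -- (3.3): macroscopic autonomy on `[0, T]` along `φ`
  (∀ m : F, ∀ δ : ℝ, 0 < δ → ∀ s t : ℝ, 0 ≤ s → s ≤ t → t ≤ T → ∃ g : ℝ → EReal,
    (∀ ε : ℝ, 0 < ε →
      Tendsto (fun N => normLog N
        (((ρ N)[|macroEvent (fun x => mN N (U N s x)) (φ s m) ε])
          (macroEvent (fun x => mN N (U N t x)) (φ t m) δ))) atTop (𝓝 (g ε))) ∧
    Tendsto g (𝓝[>] 0) (𝓝 0)) →
  ∀ m : F, ∀ s t : ℝ, 0 ≤ s → s ≤ t → t ≤ T → H (φ s m) ≤ H (φ t m)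

end Literature.MathematicalPhysics.StatisticalMechanics
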